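import Mathlib
import Literature.AlgebraicGeometry.Resolution.AlterationsLemma32
import Literature.AlgebraicGeometry.Resolution.AlterationsSectionDivisor
import Literature.AlgebraicGeometry.Resolution.NonPrincipalLocus
import Literature.AlgebraicGeometry.Dimension.PointDimension
import Literature.AlgebraicGeometry.Dimension.FibreLocalRingDimension
import Literature.AlgebraicGeometry.Motives.BettiCycleClassProofs
import Summits.ResolutionOfSingularities.ResolutionOfSingularities.Theorems.WeightedInvariantELadderOneStage
import Summits.ResolutionOfSingularities.ResolutionOfSingularities.Theorems.WeightedInvariantELadderOneStageInv
import Summits.ResolutionOfSingularities.ResolutionOfSingularities.Theorems.WeightedInvariantELadderOneOrbitOfDim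
import Summits.ResolutionOfSingularities.ResolutionOfSingularities.Theorems.WeightedInvariantHypersurfaceCentreAssemblyIotaMaxPos
import Summits.ResolutionOfSingularities.ResolutionOfSingularities.Theorems.WeightedInvariantTorusChartDimension
import HarnessLib

/-!
# Rung `e = 1`: transversal dimension two from the dimension datum — (I1) is a consequence of (I0)

Route `ResolutionOfSingularities/WeightedInvariant`, door crux `HypersurfaceCentreConstruction`
(stmt-ResolutionOfSingularities-19897), e-ladder `e = 1` of `res-L1-w43-stub-10` (cell res-hironaka); invariant
`Stage.Inv' = (I0) ∧ (I1) ∧ (I2w)` (`Theorems/WeightedInvariantELadderOneStageInv.lean`, p513926).  Companion of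
`Theorems/WeightedInvariantELadderOneOrbitOfDim.lean` ((I0) ⇒ (I2w), p515116): here **(I0) ⇒ (I1)**, so that the
whole invariant of the rung follows from the dimension datum `dim X = j + 1` (`Stage.inv'_of_invDim`) and the
successor step `stub_e1_inv_succ` owes exactly (I0′) `dim X′ = j + 2`.  For a maximal singular point
`η = i x` of a stage with `dim X = j + 1`:

* `Stage.height_eq_of_mem_maxSing` — `dim closure {η} = j` (≤ by (I0), `Stage.height_le_of_mem_singImage`;
  ≥ because a unit chart through `η` gives `j ≤ dim Γ(W) ⧸ 𝔭(η)`, `TorusChartDim.le_ringKrullDim_quotient`);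
* `Stage.ringKrullDim_stalk_eq_one_of_mem_maxSing` — `dim 𝒪_{X,x} = 1`
  (`coheight x + height x = dim X`, `Literature.AlgebraicGeometry.Dimension.coheight_add_height_eq_topologicalKrullDim`);
* `Stage.invReg_of_invDim` — `𝒪_{Y,η}` is regular (smooth over a field) of dimension
  `dim 𝒪_{Y,η}/(g) + 1 = dim 𝒪_{X,x} + 1 = 2`, `g` the local equation (a non-zero prime of the regular domain
  `𝒪_{Y,η}`, `prime_localGenerator_of_mem_singImage`; Stacks 00KW
  `ringKrullDim_quotient_span_singleton_succ_eq_ringKrullDim_of_mem_nonZeroDivisors`);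
* `Stage.inv'_of_invDim` — **`(I0) ⇒ Inv'`**.

Nothing here is a claim about Hironaka's problem; AI-written, weaker than expert review.
-/

noncomputable section

set_option linter.dupNamespace false -- mandated namespace of this single-conjunct summit

open CategoryTheory AlgebraicGeometry TopologicalSpace IsLocalRing
open Literature.AlgebraicGeometry.Resolution
open Summit.ResolutionOfSingularities.ResolutionOfSingularities.Theorems
open Summit.ResolutionOfSingularities.ResolutionOfSingularities.Cruxes.HypersurfaceCentreConstruction.LocalEngine

namespace Summit.ResolutionOfSingularities.ResolutionOfSingularities.Theorems.ELadderOne.Stage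

variable {k : Type} [Field k] (S : Stage k)

/-! ## The closure of a maximal singular point has dimension exactly `j` -/

/-- **Under (I0), `dim closure {η} = j` at every maximal singular point `η`** (≤ from (I0); ≥ from the units
of a unit chart through `η`: `j ≤ dim Γ(Y, W a) ⧸ 𝔭(η)`). [folklore] -/
theorem height_eq_of_mem_maxSing (h0 : S.InvDim) {η : S.Y} (hη : η ∈ S.maxSing) :
    Order.height η = (S.j : ℕ∞) := by
  refine le_antisymm (S.height_le_of_mem_singImage h0 hη.1) ?_
  obtain ⟨x, hx⟩ := mem_range_of_mem_singImage S hη.1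
  obtain ⟨a, hxa, ha⟩ := S.exists_isUnitChart x
  have hηa : η ∈ (S.atlas.W a : S.Y.Opens) := hx ▸ hxa
  letI := S.atlas.gradedRing a
  have hle := TorusChartDim.le_ringKrullDim_quotient (S.atlas.piece a)
    ((S.atlas.W a).2.primeIdealOf ⟨η, hηa⟩).asIdeal (S.isHomogeneous_primeIdealOf_of_mem_maxSing a hη hηa)
    ((S.atlas.W a).2.primeIdealOf ⟨η, hηa⟩).2.ne_top (Nat.pos_iff_ne_zero.mp S.atlas.exponent_pos)
    (fun i => S.exists_isUnit_quotient_of_isUnitChart ha hηa ⟨x, hx⟩ (Pi.single i 1))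
  rw [← Literature.AlgebraicGeometry.Dimension.Scheme.height_eq_ringKrullDim_quotient_primeIdealOf S.f
    (S.atlas.W a).2 hηa] at hle
  exact_mod_cast hle

/-- **Under (I0), `dim 𝒪_{X,x} = 1` at every point `x` of `X` over a maximal singular point**
(`coheight x + height x = dim X = j + 1` for the integral `X` of finite type over `k`, and
`height x = height (i x) = j`). [folklore] -/
theorem ringKrullDim_stalk_eq_one_of_mem_maxSing (h0 : S.InvDim) {x : S.X} (hx : S.i.base x ∈ S.maxSing) :
    ringKrullDim (S.X.presheaf.stalk x) = ((1 : ℕ) : WithBot ℕ∞) := by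
  have hsum := Literature.AlgebraicGeometry.Dimension.coheight_add_height_eq_topologicalKrullDim
    (S.i ≫ S.f) x
  rw [h0] at hsum
  have hh : Order.height x = (S.j : ℕ∞) := by
    rw [← Literature.AlgebraicGeometry.Motives.Scheme.height_base_eq_of_isClosedImmersion S.i x]
    exact S.height_eq_of_mem_maxSing h0 hx
  have h1 : Order.coheight x + Order.height x = (S.j : ℕ∞) + 1 := by exact_mod_cast hsum
  rw [hh] at h1
  have hco : Order.coheight x = 1 :=
    ENat.add_left_injective_of_ne_top (ENat.coe_ne_top S.j) (by simpa [add_comm] using h1)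
  rw [ringKrullDim_stalk_eq_coheight, hco]
  rfl

/-! ## (I1) from (I0) -/

/-- **(I0) ⇒ (I1): at a maximal singular point the ambient local ring is regular of dimension `2`.**  `Y` is
smooth over a field, so `𝒪_{Y,η}` is regular (`Scheme.IsRegular.of_smooth`); the stalk of `ker i` at
`η = i x` is generated by the local equation `g`, a non-zero prime of the domain `𝒪_{Y,η}`
(`prime_localGenerator_of_mem_singImage`), with `𝒪_{Y,η}/(g) ≅ 𝒪_{X,x}` of dimension `1`; hence
`dim 𝒪_{Y,η} = dim 𝒪_{X,x} + 1 = 2` (Stacks 00KW). [folklore] -/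
theorem invReg_of_invDim (h0 : S.InvDim) : S.InvReg := by
  intro η hη
  haveI : IsLocallyNoetherian S.Y := LocallyOfFiniteType.isLocallyNoetherian S.f
  have hYreg : Scheme.IsRegular S.Y := Scheme.IsRegular.of_smooth S.f (Scheme.isRegular_Spec (.of k))
  haveI hreg : IsRegularLocalRing (S.Y.presheaf.stalk η) := hYreg η
  refine ⟨hreg, ?_⟩
  -- a point of `X` under `η`
  obtain ⟨x, hx⟩ := mem_range_of_mem_singImage S hη.1
  subst hx
  -- `𝒪_{Y,η} ⧸ (ker i)_η ≅ 𝒪_{X,x}` has dimension `1`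
  have hker : stalkIdeal S.i.ker (S.i.base x) = RingHom.ker (S.i.stalkMap x).hom :=
    stalkIdeal_ker_eq_ker_stalkMap S.i x
  have e : (S.Y.presheaf.stalk (S.i.base x) ⧸ stalkIdeal S.i.ker (S.i.base x)) ≃+*
      S.X.presheaf.stalk x :=
    (Ideal.quotEquivOfEq hker).trans
      (RingHom.quotientKerEquivOfSurjective (S.i.stalkMap_surjective x))
  have hdimq : ringKrullDim (S.Y.presheaf.stalk (S.i.base x) ⧸ stalkIdeal S.i.ker (S.i.base x)) =
      ((1 : ℕ) : WithBot ℕ∞) := by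
    rw [ringKrullDim_eq_of_ringEquiv e, S.ringKrullDim_stalk_eq_one_of_mem_maxSing h0 hη]
  -- the local equation: a non-zero prime of the regular domain `𝒪_{Y,η}`
  haveI : IsIntegral S.i.ker.subscheme := Literature.AlgebraicGeometry.Motives.isIntegral_image_of_isIntegral S.i
  have hspan : stalkIdeal S.i.ker (S.i.base x) = Ideal.span {localGenerator S.i.ker (S.i.base x)} :=
    stalkIdeal_eq_span_localGenerator S.i.ker (S.i.base x)
      (S.isLocallyPrincipal (S.i.base x)).isPrincipal_stalkIdeal.principal
  have hprime : Prime (localGenerator S.i.ker (S.i.base x)) :=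
    prime_localGenerator_of_mem_singImage S.i.ker S.isLocallyPrincipal hη.1
  haveI := isDomain_of_isRegularLocalRing (S.Y.presheaf.stalk (S.i.base x))
  have hreg' : localGenerator S.i.ker (S.i.base x) ∈ nonZeroDivisors (S.Y.presheaf.stalk (S.i.base x)) :=
    mem_nonZeroDivisors_of_ne_zero hprime.ne_zero
  have hmax : localGenerator S.i.ker (S.i.base x) ∈ maximalIdeal (S.Y.presheaf.stalk (S.i.base x)) := by
    have h := (mem_support_iff_stalkIdeal_le S.i.ker (S.i.base x)).mp (mem_support_of_mem_singImage S.i.ker hη.1)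
    rw [hspan] at h
    exact h (Ideal.mem_span_singleton_self _)
  -- `dim 𝒪_{Y,η} = dim 𝒪_{Y,η}/(g) + 1 = 2`
  have hkey := ringKrullDim_quotient_span_singleton_succ_eq_ringKrullDim_of_mem_nonZeroDivisors hreg' hmax
  rw [← hspan, hdimq] at hkey
  rw [← hkey]
  rfl

/-- **`Inv'` is a consequence of the dimension datum (I0)** (`invReg_of_invDim`, `invOrbit_of_invDim`).
[folklore] -/
theorem inv'_of_invDim (h0 : S.InvDim) : S.Inv' :=
  S.inv'_of_invDim_of_invReg h0 (S.invReg_of_invDim h0)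

end Summit.ResolutionOfSingularities.ResolutionOfSingularities.Theorems.ELadderOne.Stage

end
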